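import Summits.FinalStateConjecture.FinalStateConjecture.Theorems.ClusterCompletenessAdiabaticMultiKerrILEDLateCollar
import Summits.FinalStateConjecture.FinalStateConjecture.Theorems.ClusterCompletenessAdiabaticMultiKerrILEDLateTransport
import HarnessLib

/-!
# Route ClusterCompleteness — crux `AdiabaticMultiKerrILED`, line `Sketch`: the lossy integral
# inequality for the total collar energy (helper for `stub_lateAssembly`)

Helper file for the crux `stmt-FinalStateConjecture-14310`
(`Summit.FinalStateConjecture.FinalStateConjecture.Theses.ClusterCompleteness.AdiabaticMultiKerrILED`),
line `Sketch`, serving the lead's assembly stub `stub_lateAssembly` (Dafermos–Rodnianski's red-shift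
boundedness argument, arXiv:0811.0354 §3.3.4, on the lab foliation).

`late_integral_inequality`: summing the per-hole red-shift estimates between lab slices
(`collar_redshift_lab`, hypothesis `hRSlab`) over the holes, bounding every shell term by the far
energy (`shell_subset_far` + the gradient comparability `hcmp`) and the far energy by a constant `W`
from a time `t₁` on (hypothesis `hFar`, the research stub `stub_farEnergyBound_pos`), one gets for
the total half-collar quantity `G(τ) = Σᵢ ∫ (1_{(r₊ᵢ, r₊ᵢ + ηMᵢ/2]} Σ(∂Φᵢ)²)(qᵢ(τ, y)) dy` the lossy
integral inequality `G(s₂) + ∫_{s₁}^{s₂} G ≤ 2 C U · G(s₁) + 2 C U N κ W (1 + (s₂ − s₁))` for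
`max(t₁, 0) ≤ s₁ ≤ s₂` (`U ≥ 1` dominates every `uᵢ⁰ ≥ 1`, `C ≥ Cᵢ`, `κ ≥ κᵢ`) — the
hypothesis of `stub_boundedOfIntegralIneq`. [folklore]
-/

noncomputable section

-- the doubled `FinalStateConjecture.FinalStateConjecture` path component trips dupNamespace
set_option linter.dupNamespace false

open scoped ENNReal BigOperators InnerProductSpace ContDiff
open Set MeasureTheory Literature.Geometry.Lorentzian

namespace Summit.FinalStateConjecture.FinalStateConjecture.Cruxes.AdiabaticMultiKerrILED.Sketch

/-- `∫_{(s₁, s₂]} c = c (s₂ − s₁)` for a constant in `[0, ∞]` and `s₁ ≤ s₂`. [folklore] -/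
private theorem li_setLIntegral_Ioc_const (c : ℝ≥0∞) (s₁ s₂ : ℝ) :
    ∫⁻ _ in Set.Ioc s₁ s₂, c = c * ENNReal.ofReal (s₂ - s₁) := by
  rw [setLIntegral_const, Real.volume_Ioc, mul_comm]

/-- **The lossy integral inequality for the total collar energy** (see the module docstring):
the sum over the holes of the lab-slice red-shift inequalities, with the shell terms bounded by
the far energy. [folklore] -/
theorem late_integral_inequality {N : ℕ} {M a : Fin N → ℝ} {Λ : Fin N → lorentzGroup}
    {p : Fin N → E3} {u : Fin N → E4} {q : Fin N → E4 → E4}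
    (hu : ∀ i, u i = (Λ i : E4 ≃L[ℝ] E4) (E4.basisVector 0))
    (hq : ∀ i x, q i x = poincareInv (Λ i) (E4.ofTimeSpace 0 (p i)) x)
    (hM : ∀ i, 0 < M i) (ha : ∀ i, |a i| ≤ 2⁻¹ * M i)
    (hv : ∀ i, 0 < u i 0 ∧ ‖E4.spatial (u i)‖ ≤ 2⁻¹ * u i 0)
    (hsep : ∀ i j, i ≠ j → 40 * (M i + M j) ≤ dist (p i) (p j) ∧
      0 < ⟪p i - p j, (u i 0)⁻¹ • E4.spatial (u i) - (u j 0)⁻¹ • E4.spatial (u j)⟫_ℝ)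
    {η : ℝ} (hη1 : η ≤ 1) {κ C : Fin N → ℝ}
    {U Cs κs : ℝ} (hU : ∀ i, u i 0 ≤ U) (hU1 : ∀ i, 1 ≤ u i 0) (hU0 : 1 ≤ U)
    (hCs : ∀ i, C i ≤ Cs) (hCs0 : 0 ≤ Cs) (hκs : ∀ i, κ i ≤ κs)
    {ψ : E4 → ℝ} (hψ : ContDiff ℝ 1 ψ) {Φ : Fin N → E4 → ℝ} (hΦ : ∀ i, ContDiff ℝ 1 (Φ i))
    (hcmp : ∀ i x, ENNReal.ofReal (∑ μ, fderiv ℝ (Φ i) (q i x) (E4.basisVector μ) ^ 2) ≤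
      ENNReal.ofReal (κ i) * ENNReal.ofReal (∑ μ : Fin 4, (fderiv ℝ ψ x (E4.basisVector μ)) ^ 2))
    {t₁ : ℝ} {W : ℝ≥0∞}
    (hFar : ∀ τ : ℝ, t₁ ≤ τ → 0 ≤ τ →
      ∫⁻ y in {y : E3 | ∀ i, Kerr.rPlus (M i) (a i) + η / 2 * M i ≤
          Kerr.radius (a i) (q i (E4.ofTimeSpace τ y))},
        ENNReal.ofReal (∑ μ : Fin 4, (fderiv ℝ ψ (E4.ofTimeSpace τ y) (E4.basisVector μ)) ^ 2) ≤ W)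
    (hRSlab : ∀ (i : Fin N) (s₁ s₂ : ℝ), 0 ≤ s₁ → s₁ ≤ s₂ →
      (∫⁻ y : E3, {z : E4 | Kerr.rPlus (M i) (a i) < Kerr.radius (a i) z ∧
            Kerr.radius (a i) z ≤ Kerr.rPlus (M i) (a i) + η * M i / 2}.indicator
          (fun z ↦ ENNReal.ofReal (∑ μ, fderiv ℝ (Φ i) z (E4.basisVector μ) ^ 2))
          (q i (E4.ofTimeSpace s₂ y))) +
        ENNReal.ofReal (u i 0)⁻¹ * ∫⁻ τ in Set.Ioc s₁ s₂, ∫⁻ y : E3,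
          {z : E4 | Kerr.rPlus (M i) (a i) < Kerr.radius (a i) z ∧
              Kerr.radius (a i) z ≤ Kerr.rPlus (M i) (a i) + η * M i / 2}.indicator
            (fun z ↦ ENNReal.ofReal (∑ μ, fderiv ℝ (Φ i) z (E4.basisVector μ) ^ 2))
            (q i (E4.ofTimeSpace τ y)) ≤
      ENNReal.ofReal (C i / 2⁻¹) *
        ((∫⁻ y : E3, {z : E4 | Kerr.rPlus (M i) (a i) < Kerr.radius (a i) z ∧
              Kerr.radius (a i) z ≤ Kerr.rPlus (M i) (a i) + η * M i}.indicator
            (fun z ↦ ENNReal.ofReal (∑ μ, fderiv ℝ (Φ i) z (E4.basisVector μ) ^ 2))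
            (q i (E4.ofTimeSpace s₁ y))) +
          ENNReal.ofReal (u i 0)⁻¹ * ∫⁻ τ in Set.Ioc s₁ s₂, ∫⁻ y : E3,
            {z : E4 | Kerr.rPlus (M i) (a i) + η * M i / 2 ≤ Kerr.radius (a i) z ∧
                Kerr.radius (a i) z ≤ Kerr.rPlus (M i) (a i) + η * M i}.indicator
              (fun z ↦ ENNReal.ofReal (∑ μ, fderiv ℝ (Φ i) z (E4.basisVector μ) ^ 2))
              (q i (E4.ofTimeSpace τ y)))) :
    ∀ s₁ s₂ : ℝ, max t₁ 0 ≤ s₁ → s₁ ≤ s₂ →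
      (∑ i, ∫⁻ y : E3, {z : E4 | Kerr.rPlus (M i) (a i) < Kerr.radius (a i) z ∧
            Kerr.radius (a i) z ≤ Kerr.rPlus (M i) (a i) + η * M i / 2}.indicator
          (fun z ↦ ENNReal.ofReal (∑ μ, fderiv ℝ (Φ i) z (E4.basisVector μ) ^ 2))
          (q i (E4.ofTimeSpace s₂ y))) +
        ∫⁻ τ in Set.Ioc s₁ s₂, ∑ i, ∫⁻ y : E3,
          {z : E4 | Kerr.rPlus (M i) (a i) < Kerr.radius (a i) z ∧
              Kerr.radius (a i) z ≤ Kerr.rPlus (M i) (a i) + η * M i / 2}.indicator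
            (fun z ↦ ENNReal.ofReal (∑ μ, fderiv ℝ (Φ i) z (E4.basisVector μ) ^ 2))
            (q i (E4.ofTimeSpace τ y)) ≤
      ENNReal.ofReal (2 * Cs * U) *
          (∑ i, ∫⁻ y : E3, {z : E4 | Kerr.rPlus (M i) (a i) < Kerr.radius (a i) z ∧
              Kerr.radius (a i) z ≤ Kerr.rPlus (M i) (a i) + η * M i / 2}.indicator
            (fun z ↦ ENNReal.ofReal (∑ μ, fderiv ℝ (Φ i) z (E4.basisVector μ) ^ 2))
            (q i (E4.ofTimeSpace s₁ y))) +
        ENNReal.ofReal (2 * Cs * U * (N * κs)) * W * ENNReal.ofReal (1 + (s₂ - s₁)) := by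
  -- ### notation
  set e : Fin N → E4 → ℝ≥0∞ := fun i z ↦
    ENNReal.ofReal (∑ μ, fderiv ℝ (Φ i) z (E4.basisVector μ) ^ 2) with he
  set eψ : E4 → ℝ≥0∞ := fun x ↦
    ENNReal.ofReal (∑ μ : Fin 4, (fderiv ℝ ψ x (E4.basisVector μ)) ^ 2) with heψ
  set T1 : Fin N → Set E4 := fun i ↦ {z : E4 | Kerr.rPlus (M i) (a i) < Kerr.radius (a i) z ∧
    Kerr.radius (a i) z ≤ Kerr.rPlus (M i) (a i) + η * M i / 2} with hT1
  set T2 : Fin N → Set E4 := fun i ↦ {z : E4 | Kerr.rPlus (M i) (a i) < Kerr.radius (a i) z ∧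
    Kerr.radius (a i) z ≤ Kerr.rPlus (M i) (a i) + η * M i} with hT2
  set Sh : Fin N → Set E4 := fun i ↦ {z : E4 | Kerr.rPlus (M i) (a i) + η * M i / 2 ≤
    Kerr.radius (a i) z ∧ Kerr.radius (a i) z ≤ Kerr.rPlus (M i) (a i) + η * M i} with hSh
  set A1 : Fin N → ℝ → ℝ≥0∞ := fun i τ ↦
    ∫⁻ y : E3, (T1 i).indicator (e i) (q i (E4.ofTimeSpace τ y)) with hA1
  set A2 : Fin N → ℝ → ℝ≥0∞ := fun i τ ↦
    ∫⁻ y : E3, (T2 i).indicator (e i) (q i (E4.ofTimeSpace τ y)) with hA2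
  set A3 : Fin N → ℝ → ℝ≥0∞ := fun i τ ↦
    ∫⁻ y : E3, (Sh i).indicator (e i) (q i (E4.ofTimeSpace τ y)) with hA3
  intro s₁ s₂ hs₁ hs
  show (∑ i, A1 i s₂) + ∫⁻ τ in Set.Ioc s₁ s₂, ∑ i, A1 i τ ≤
    ENNReal.ofReal (2 * Cs * U) * (∑ i, A1 i s₁) +
      ENNReal.ofReal (2 * Cs * U * (N * κs)) * W * ENNReal.ofReal (1 + (s₂ - s₁))
  have hs₁0 : 0 ≤ s₁ := (le_max_right _ _).trans hs₁
  have hs₁t : t₁ ≤ s₁ := (le_max_left _ _).trans hs₁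
  -- ### measurability
  have hqc : ∀ i, Continuous (q i) := fun i ↦ by
    rw [show q i = poincareInv (Λ i) (E4.ofTimeSpace 0 (p i)) from funext (hq i)]
    exact continuous_poincareInv _ _
  have hem : ∀ i, Measurable (e i) := fun i ↦ measurable_energyDensity (hΦ i)
  have hT1m : ∀ i, MeasurableSet (T1 i) := fun i ↦ (measurableSet_radius_collar _ _ _).1
  have hA1m : ∀ i, Measurable (A1 i) := fun i ↦
    measurable_lintegral_comp_slice ((hem i).indicator (hT1m i)) (hqc i)
  have hFarm : ∀ τ : ℝ, MeasurableSet {y : E3 | ∀ i, Kerr.rPlus (M i) (a i) + η / 2 * M i ≤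
      Kerr.radius (a i) (q i (E4.ofTimeSpace τ y))} := fun τ ↦
    (measurableSet_slice_sets (fun i x ↦ Kerr.radius (a i) (q i x))
      (fun i ↦ (Kerr.continuous_radius (a i)).comp (hqc i))
      (fun i ↦ Kerr.rPlus (M i) (a i) + η / 2 * M i) (fun _ ↦ 0) τ).2.1
  have heψm : ∀ τ : ℝ, Measurable fun y : E3 ↦ eψ (E4.ofTimeSpace τ y) := fun τ ↦
    (measurable_energyDensity hψ).comp (E4.continuous_ofTimeSpace τ).measurable
  -- ### the shell terms are bounded by the far energy, hence by `κᵢ W`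
  have hA3 : ∀ i τ, s₁ ≤ τ → A3 i τ ≤ ENNReal.ofReal (κ i) * W := by
    intro i τ hτ
    have hτ0 : 0 ≤ τ := hs₁0.trans hτ
    calc A3 i τ ≤ ENNReal.ofReal (κ i) * ∫⁻ y in {y : E3 | ∀ j, Kerr.rPlus (M j) (a j) +
          η / 2 * M j ≤ Kerr.radius (a j) (q j (E4.ofTimeSpace τ y))}, eψ (E4.ofTimeSpace τ y) := by
          refine lintegral_indicator_comp_le_setLIntegral (hFarm τ) (heψm τ)
            fun y hy ↦ ⟨?_, hcmp i _⟩
          exact shell_subset_far hu hq hM ha hv hsep hη1 hτ0 i hy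
      _ ≤ ENNReal.ofReal (κ i) * W := by
          gcongr
          exact hFar τ (hs₁t.trans hτ) hτ0
  -- ### the full collar at `s₁` splits into the half collar and the shell
  have hA2 : ∀ i, A2 i s₁ ≤ A1 i s₁ + A3 i s₁ := by
    intro i
    refine lintegral_indicator_comp_le_add (fun z hz ↦ ?_) (e i)
      (((hem i).indicator (hT1m i)).comp ((hqc i).comp (E4.continuous_ofTimeSpace s₁)).measurable)
    by_cases h : Kerr.radius (a i) z ≤ Kerr.rPlus (M i) (a i) + η * M i / 2
    · exact Or.inl ⟨hz.1, h⟩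
    · exact Or.inr ⟨(not_le.mp h).le, hz.2⟩
  -- ### per hole: red-shift, then the bounds above
  have hW : ∀ i, ENNReal.ofReal (κ i) * W ≤ ENNReal.ofReal κs * W := fun i ↦ by
    gcongr; exact hκs i
  set X : ℝ≥0∞ := ENNReal.ofReal κs * W * ENNReal.ofReal (1 + (s₂ - s₁)) with hX
  have hhole : ∀ i, A1 i s₂ + ENNReal.ofReal U⁻¹ * ∫⁻ τ in Set.Ioc s₁ s₂, A1 i τ ≤
      ENNReal.ofReal (2 * Cs) * A1 i s₁ + ENNReal.ofReal (2 * Cs) * X := by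
    intro i
    have hu0 : 0 < u i 0 := (hv i).1
    have hUi : ENNReal.ofReal U⁻¹ ≤ ENNReal.ofReal (u i 0)⁻¹ :=
      ENNReal.ofReal_le_ofReal (inv_anti₀ hu0 (hU i))
    have hui1 : ENNReal.ofReal (u i 0)⁻¹ ≤ 1 := by
      rw [← ENNReal.ofReal_one]
      exact ENNReal.ofReal_le_ofReal (inv_le_one_of_one_le₀ (hU1 i))
    have hCi : ENNReal.ofReal (C i / 2⁻¹) ≤ ENNReal.ofReal (2 * Cs) :=
      ENNReal.ofReal_le_ofReal (by rw [div_inv_eq_mul]; linarith [hCs i])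
    have hint3 : ∫⁻ τ in Set.Ioc s₁ s₂, A3 i τ ≤
        ENNReal.ofReal κs * W * ENNReal.ofReal (s₂ - s₁) := by
      calc ∫⁻ τ in Set.Ioc s₁ s₂, A3 i τ ≤ ∫⁻ _ in Set.Ioc s₁ s₂, ENNReal.ofReal κs * W :=
            setLIntegral_mono' measurableSet_Ioc fun τ hτ ↦ (hA3 i τ hτ.1.le).trans (hW i)
        _ = ENNReal.ofReal κs * W * ENNReal.ofReal (s₂ - s₁) := li_setLIntegral_Ioc_const _ _ _
    have hred := hRSlab i s₁ s₂ hs₁0 hs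
    calc A1 i s₂ + ENNReal.ofReal U⁻¹ * ∫⁻ τ in Set.Ioc s₁ s₂, A1 i τ
        ≤ A1 i s₂ + ENNReal.ofReal (u i 0)⁻¹ * ∫⁻ τ in Set.Ioc s₁ s₂, A1 i τ := by gcongr
      _ ≤ ENNReal.ofReal (C i / 2⁻¹) *
            (A2 i s₁ + ENNReal.ofReal (u i 0)⁻¹ * ∫⁻ τ in Set.Ioc s₁ s₂, A3 i τ) := hred
      _ ≤ ENNReal.ofReal (2 * Cs) *
            ((A1 i s₁ + ENNReal.ofReal κs * W) +
              1 * (ENNReal.ofReal κs * W * ENNReal.ofReal (s₂ - s₁))) := by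
          gcongr
          exact (hA2 i).trans (add_le_add le_rfl ((hA3 i s₁ le_rfl).trans (hW i)))
      _ = ENNReal.ofReal (2 * Cs) * A1 i s₁ + ENNReal.ofReal (2 * Cs) * X := by
          rw [hX, ENNReal.ofReal_add zero_le_one (sub_nonneg.mpr hs), ENNReal.ofReal_one]
          ring
  -- ### sum over the holes
  have hsum_int : ∫⁻ τ in Set.Ioc s₁ s₂, ∑ i, A1 i τ = ∑ i, ∫⁻ τ in Set.Ioc s₁ s₂, A1 i τ :=
    lintegral_finsetSum' _ fun i _ ↦ (hA1m i).aemeasurable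
  have hUU : ENNReal.ofReal U * ENNReal.ofReal U⁻¹ = 1 := by
    rw [← ENNReal.ofReal_mul (by linarith), mul_inv_cancel₀ (by linarith), ENNReal.ofReal_one]
  have hU1' : (1 : ℝ≥0∞) ≤ ENNReal.ofReal U := ENNReal.one_le_ofReal.2 hU0
  have hc1 : ENNReal.ofReal U * ENNReal.ofReal (2 * Cs) = ENNReal.ofReal (2 * Cs * U) := by
    rw [← ENNReal.ofReal_mul (by linarith)]
    congr 1; ring
  have hc2 : ENNReal.ofReal U * (N : ℝ≥0∞) * ENNReal.ofReal (2 * Cs) * ENNReal.ofReal κs =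
      ENNReal.ofReal (2 * Cs * U * (N * κs)) := by
    rw [← ENNReal.ofReal_natCast, ← ENNReal.ofReal_mul (by linarith),
      ← ENNReal.ofReal_mul (by positivity), ← ENNReal.ofReal_mul (by positivity)]
    congr 1; ring
  calc (∑ i, A1 i s₂) + ∫⁻ τ in Set.Ioc s₁ s₂, ∑ i, A1 i τ
      ≤ ENNReal.ofReal U * (∑ i, A1 i s₂) + ∫⁻ τ in Set.Ioc s₁ s₂, ∑ i, A1 i τ := by
        gcongr
        exact le_mul_of_one_le_left' hU1'
    _ = ENNReal.ofReal U *
          ((∑ i, A1 i s₂) + ENNReal.ofReal U⁻¹ * ∫⁻ τ in Set.Ioc s₁ s₂, ∑ i, A1 i τ) := by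
        rw [mul_add, ← mul_assoc, hUU, one_mul]
    _ = ENNReal.ofReal U * ∑ i, (A1 i s₂ + ENNReal.ofReal U⁻¹ * ∫⁻ τ in Set.Ioc s₁ s₂, A1 i τ) := by
        rw [hsum_int, Finset.mul_sum, Finset.sum_add_distrib]
    _ ≤ ENNReal.ofReal U * ∑ i, (ENNReal.ofReal (2 * Cs) * A1 i s₁ + ENNReal.ofReal (2 * Cs) * X) := by
        exact mul_le_mul' le_rfl (Finset.sum_le_sum fun i _ ↦ hhole i)
    _ = ENNReal.ofReal U * (ENNReal.ofReal (2 * Cs) * ∑ i, A1 i s₁ +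
          (N : ℝ≥0∞) * (ENNReal.ofReal (2 * Cs) * X)) := by
        rw [Finset.sum_add_distrib, Finset.mul_sum, Finset.sum_const, Finset.card_univ,
          Fintype.card_fin, nsmul_eq_mul]
    _ = ENNReal.ofReal U * ENNReal.ofReal (2 * Cs) * ∑ i, A1 i s₁ +
          ENNReal.ofReal U * (N : ℝ≥0∞) * ENNReal.ofReal (2 * Cs) * ENNReal.ofReal κs * W *
            ENNReal.ofReal (1 + (s₂ - s₁)) := by
        rw [hX]; ring
    _ = ENNReal.ofReal (2 * Cs * U) * (∑ i, A1 i s₁) +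
          ENNReal.ofReal (2 * Cs * U * (N * κs)) * W * ENNReal.ofReal (1 + (s₂ - s₁)) := by
        rw [hc1, hc2]

end Summit.FinalStateConjecture.FinalStateConjecture.Cruxes.AdiabaticMultiKerrILED.Sketch

end
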